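import Mathlib
import HarnessLib
import Summits.AtomisticToContinuum.FouriersLaw.Theses.JunctionLocality
import Summits.AtomisticToContinuum.FouriersLaw.Theorems.JunctionLocalitySuperadditiveResistanceKuboLimit

/-!
# Kubo–Onsager for the γ-thermostatted pinned chain, V: momentum reversal and Onsager symmetry

Helper file (`--supports` stmt-AtomisticToContinuum-11748) for stub `stub_kuboOnsager` of the line
`floating-probe-bypass-laplacian` (crux `JunctionLocality.SuperadditiveResistance`).

* `rev f (q, p) = f (q, −p)` — momentum reversal on observables, with its calculus:
  `∂_{p_i}(rev f) = −rev(∂_{p_i} f)`, `∂_{q_i}(rev f) = rev(∂_{q_i} f)`, `X_H (rev f) = −rev (X_H f)`,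
  `S_B (rev f) = rev (S_B f)`; hence a `σ`-pair `(f, k)` gives the `(−σ)`-pair `(rev f, rev k)` (`rev_pair`):
  the formal `μ_T`-adjoint of `X_H + c S_B` is `−X_H + c S_B = Π (X_H + c S_B) Π`.
* `integral_rev_mul_gibbsDensity` — `e^{-H/T} dq dp` is reversal invariant.
* `onsager_symmetry` — for two FORWARD pairs `(f, k_f)`, `(h, k_h)` (same `σ`) with EVEN sources
  (`rev k_f = k_f`, `rev k_h = k_h`), `f, h ∈ C² ∩ L²(μ_T)`, `k_f, k_h ∈ L²(μ_T)`, `B ≥ 0`, `c > 0`: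
  `∫ h k_f ρ = ∫ f k_h ρ`, i.e. `⟨(−L)⁻¹k_h, k_f⟩ = ⟨(−L)⁻¹k_f, k_h⟩` — ONSAGER RECIPROCITY of the equilibrium
  Kubo matrix (apply `cross` of part IV to `f` and `rev h`).
References: Onsager 1931; Eckmann–Pillet–Rey-Bellet 1999 §3 (time-reversal `L* = ΠLΠ`); folklore.
-/

noncomputable section

open MeasureTheory Filter Topology ProbabilityTheory
open scoped ContDiff NNReal ENNReal
open Literature.MathematicalPhysics.KineticTheory.HeatConduction
open Summit.AtomisticToContinuum.FouriersLaw.Theorems.SuperadditiveResistance.DeviceLiouville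

namespace Summit.AtomisticToContinuum.FouriersLaw.Theorems.SuperadditiveResistance.Kubo

section Reversal

variable {L : ℕ}

/-- Momentum reversal on observables: `rev f (q, p) = f (q, −p)`. [folklore] -/
def rev (f : PhaseSpace L → ℝ) (x : PhaseSpace L) : ℝ := f (x.1, -x.2)

/-- `rev` is an involution. [folklore] -/
@[simp] theorem rev_rev (f : PhaseSpace L → ℝ) : rev (rev f) = f := by
  funext x; simp [rev]

/-- Unfolding `rev`. [folklore] -/
theorem rev_apply (f : PhaseSpace L → ℝ) (x : PhaseSpace L) : rev f x = f (x.1, -x.2) := rfl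

/-- The reversal map is a continuous linear map, hence smooth. [folklore] -/
theorem contDiff_reversal {n : WithTop ℕ∞} :
    ContDiff ℝ n (fun x : PhaseSpace L => ((x.1, -x.2) : PhaseSpace L)) :=
  contDiff_fst.prodMk contDiff_snd.neg

/-- `rev f` is as smooth as `f`. [folklore] -/
theorem contDiff_rev {n : WithTop ℕ∞} {f : PhaseSpace L → ℝ} (hf : ContDiff ℝ n f) : ContDiff ℝ n (rev f) :=
  hf.comp contDiff_reversal

/-- `rev f` is continuous if `f` is. [folklore] -/
theorem continuous_rev {f : PhaseSpace L → ℝ} (hf : Continuous f) : Continuous (rev f) :=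
  hf.comp (continuous_fst.prodMk continuous_snd.neg)

/-- `−(g[i ↦ t]) = (−g)[i ↦ −t]`. [folklore] -/
theorem neg_update (g : Fin L → ℝ) (i : Fin L) (t : ℝ) :
    -Function.update g i t = Function.update (-g) i (-t) := by
  funext j
  by_cases hj : j = i
  · subst hj; simp
  · simp [hj]

/-- `∂_{p_i}(rev f) = −rev(∂_{p_i} f)` (chain rule with `t ↦ −t`; no differentiability needed). [folklore] -/
theorem partialP_rev (i : Fin L) (f : PhaseSpace L → ℝ) (x : PhaseSpace L) :
    partialP i (rev f) x = -partialP i f (x.1, -x.2) := by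
  unfold partialP rev
  simp only [neg_update]
  have key := deriv_comp_neg (f := fun s => f (x.1, Function.update (-x.2) i s)) (x := x.2 i)
  rw [key]
  rfl

/-- As functions: `∂_{p_i}(rev f) = −rev(∂_{p_i} f)`. [folklore] -/
theorem partialP_rev_eq (i : Fin L) (f : PhaseSpace L → ℝ) :
    partialP i (rev f) = fun x => -rev (partialP i f) x := by
  funext x; rw [partialP_rev]; rfl

/-- `∂_{q_i}(rev f) = rev(∂_{q_i} f)`. [folklore] -/
theorem partialQ_rev (i : Fin L) (f : PhaseSpace L → ℝ) (x : PhaseSpace L) :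
    partialQ i (rev f) x = partialQ i f (x.1, -x.2) := rfl

/-- `∂_{p_i}` of a negated function. [folklore] -/
theorem partialP_neg (i : Fin L) (g : PhaseSpace L → ℝ) (x : PhaseSpace L) :
    partialP i (fun y => -g y) x = -partialP i g x := by
  unfold partialP
  exact deriv.neg

/-- `∂²_{p_i}(rev f) = rev(∂²_{p_i} f)`. [folklore] -/
theorem partialP_partialP_rev (i : Fin L) (f : PhaseSpace L → ℝ) (x : PhaseSpace L) :
    partialP i (partialP i (rev f)) x = partialP i (partialP i f) (x.1, -x.2) := by
  rw [partialP_rev_eq, partialP_neg, partialP_rev]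
  ring

variable (P : OscillatorChain)

/-- `∂_{q_i} H` is even in the momenta. [folklore] -/
theorem partialQ_hamiltonian_rev (i : Fin L) (x : PhaseSpace L) :
    partialQ i (P.hamiltonian L) (x.1, -x.2) = partialQ i (P.hamiltonian L) x := by
  rw [P.partialQ_hamiltonian_eq, P.partialQ_hamiltonian_eq]

/-- **Reversal anti-commutes with the Liouville operator**: `X_H (rev f) = −rev (X_H f)`. [folklore] -/
theorem liouvilleOp_rev (f : PhaseSpace L → ℝ) (x : PhaseSpace L) :
    liouvilleOp P L (rev f) x = -liouvilleOp P L f (x.1, -x.2) := by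
  unfold liouvilleOp
  rw [← Finset.sum_neg_distrib]
  refine Finset.sum_congr rfl fun i _ => ?_
  rw [partialQ_rev, partialP_rev, partialQ_hamiltonian_rev]
  simp only [Pi.neg_apply]
  ring

/-- **Reversal commutes with the thermostats**: `S_B (rev f) = rev (S_B f)`. [folklore] -/
theorem bathOp_rev (B : Fin L → ℝ) (T : ℝ) (f : PhaseSpace L → ℝ) (x : PhaseSpace L) :
    bathOp L B T (rev f) x = bathOp L B T f (x.1, -x.2) := by
  unfold bathOp
  refine Finset.sum_congr rfl fun i _ => ?_
  rw [partialP_partialP_rev, partialP_rev]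
  simp only [Pi.neg_apply]
  ring

/-- **A `σ`-pair reverses to a `(−σ)`-pair**: if `σ X_H f + c S_B f = −k` then
`(−σ) X_H (rev f) + c S_B (rev f) = −rev k` (the `μ_T`-adjoint `−X_H + cS_B = Π(X_H + cS_B)Π`). [folklore] -/
theorem rev_pair (B : Fin L → ℝ) (T σ c : ℝ) {f k : PhaseSpace L → ℝ}
    (hpde : ∀ x, σ * liouvilleOp P L f x + c * bathOp L B T f x = -k x) (x : PhaseSpace L) :
    -σ * liouvilleOp P L (rev f) x + c * bathOp L B T (rev f) x = -rev k x := by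
  rw [liouvilleOp_rev, bathOp_rev, rev_apply]
  have := hpde (x.1, -x.2)
  linarith

/-- The Gibbs density is even in the momenta. [folklore] -/
theorem gibbsDensity_rev (T : ℝ) (x : PhaseSpace L) : P.gibbsDensity L T (x.1, -x.2) = P.gibbsDensity L T x := by
  simp [OscillatorChain.gibbsDensity, OscillatorChain.hamiltonian_neg_momentum]

/-- **`e^{-H/T} dq dp` is reversal invariant**: `∫ (rev F) ρ = ∫ F ρ`. [folklore] -/
theorem integral_rev_mul_gibbsDensity (T : ℝ) (F : PhaseSpace L → ℝ) :
    ∫ x, rev F x * P.gibbsDensity L T x = ∫ x, F x * P.gibbsDensity L T x := by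
  have h := integral_comp_momentumReversal L fun x => F x * P.gibbsDensity L T x
  simp only [gibbsDensity_rev] at h
  exact h

/-- Integrability against `ρ` is reversal invariant. [folklore] -/
theorem integrable_rev_mul_gibbsDensity_iff (T : ℝ) (F : PhaseSpace L → ℝ) :
    Integrable (fun x => rev F x * P.gibbsDensity L T x) ↔ Integrable (fun x => F x * P.gibbsDensity L T x) := by
  have h := (measurePreserving_momentumReversal L).integrable_comp_emb
    (momentumReversal L).measurableEmbedding (g := fun x => F x * P.gibbsDensity L T x)
  refine Iff.trans ?_ h
  refine integrable_congr (ae_of_all _ fun x => ?_)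
  simp only [Function.comp_apply, momentumReversal_apply, gibbsDensity_rev, rev_apply]

end Reversal

section Symmetry

variable {ω₂ lam β γ : ℝ} {L : ℕ}

set_option hygiene false in
/-- Local shorthand for the pinned chain of this section. -/
local notation "𝐏" => pinnedChain ω₂ lam β γ

/-- A continuous `L²(μ_T)` function stays in `L²(μ_T)` under reversal. [folklore] -/
theorem memLp_rev (hω : 0 < ω₂) (hl : 0 ≤ lam) (hβ : 0 ≤ β) (L : ℕ) {T : ℝ} (hT : 0 < T)
    {f : PhaseSpace L → ℝ} (hfc : Continuous f) (hf2 : MemLp f 2 ((𝐏).gibbsMeasure L T)) :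
    MemLp (rev f) 2 ((𝐏).gibbsMeasure L T) := by
  refine memLp_of_integrable_sq_mul_gibbsDensity hω hl hβ γ L hT (continuous_rev hfc) ?_
  have h := integrable_sq_mul_gibbsDensity hω hl hβ γ L hT hf2
  rw [← integrable_rev_mul_gibbsDensity_iff (pinnedChain ω₂ lam β γ) T (fun x => f x ^ 2)] at h
  exact h

/-- **Onsager reciprocity of the equilibrium Kubo pairing.** For two `σ`-pairs `(f, k_f)`, `(h, k_h)` of the
pinned chain (`f, h ∈ C² ∩ L²(μ_T)`, `k_f, k_h ∈ L²(μ_T)`, `B ≥ 0`, `c > 0`) whose sources are EVEN in the momenta: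
`∫ h k_f e^{-H/T} = ∫ f k_h e^{-H/T}`. Proof: `rev h` is a `(−σ)`-pair with source `rev k_h = k_h`; the cross Green
identity gives `∫ (rev h) k_f ρ = ∫ f k_h ρ`, and the left side is `∫ h k_f ρ` by reversal invariance of `ρ dx`
and evenness of `k_f`. [folklore] -/
theorem onsager_symmetry (hω : 0 < ω₂) (hl : 0 ≤ lam) (hβ : 0 ≤ β) (L : ℕ) {T : ℝ} (hT : 0 < T)
    (B : Fin L → ℝ) (hB : ∀ i, 0 ≤ B i) (σ : ℝ) {c : ℝ} (hc : 0 < c) {f kf h kh : PhaseSpace L → ℝ}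
    (hf : ContDiff ℝ 2 f) (hh : ContDiff ℝ 2 h)
    (hf2 : MemLp f 2 ((𝐏).gibbsMeasure L T)) (hh2 : MemLp h 2 ((𝐏).gibbsMeasure L T))
    (hkf2 : MemLp kf 2 ((𝐏).gibbsMeasure L T)) (hkh2 : MemLp kh 2 ((𝐏).gibbsMeasure L T))
    (hkf_even : rev kf = kf) (hkh_even : rev kh = kh)
    (hpf : ∀ x, σ * liouvilleOp 𝐏 L f x + c * bathOp L B T f x = -kf x)
    (hph : ∀ x, σ * liouvilleOp 𝐏 L h x + c * bathOp L B T h x = -kh x) :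
    ∫ x, h x * kf x * (𝐏).gibbsDensity L T x = ∫ x, f x * kh x * (𝐏).gibbsDensity L T x := by
  -- rev h is a (−σ)-pair with source kh
  have hph' : ∀ x, -σ * liouvilleOp 𝐏 L (rev h) x + c * bathOp L B T (rev h) x = -kh x := by
    intro x
    have := rev_pair (pinnedChain ω₂ lam β γ) B T σ c hph x
    rwa [hkh_even] at this
  have hrh : ContDiff ℝ 2 (rev h) := contDiff_rev hh
  have hrh2 : MemLp (rev h) 2 ((𝐏).gibbsMeasure L T) := memLp_rev hω hl hβ L hT hh.continuous hh2
  have hcross := cross hω hl hβ L hT B hB σ hc hf hrh hf2 hrh2 hkf2 hkh2 hpf hph'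
  rw [← hcross]
  -- ∫ (rev h) kf ρ = ∫ h kf ρ
  have e : (fun x => rev h x * kf x * (𝐏).gibbsDensity L T x) =
      fun x => rev (fun y => h y * kf y) x * (𝐏).gibbsDensity L T x := by
    funext x
    have hk : kf (x.1, -x.2) = kf x := by
      have := congr_fun hkf_even x
      rwa [rev_apply] at this
    simp only [rev_apply, hk]
  rw [e, integral_rev_mul_gibbsDensity]

end Symmetry

/-- Registered helper sub-goal `helper_kuboOnsagerSymmetry` of stub `stub_kuboOnsager` (= `onsager_symmetry` in stub form; line
`floating-probe-bypass-laplacian`, crux stmt-AtomisticToContinuum-11748). [folklore] -/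
theorem helper_kuboOnsagerSymmetry : ∀ {ω₂ lam β γ : ℝ}, 0 < ω₂ → 0 ≤ lam → 0 ≤ β → ∀ (L : ℕ) {T : ℝ}, 0 < T → ∀ (B : Fin L → ℝ), (∀ i, 0 ≤ B i) → ∀ (σ : ℝ) {c : ℝ}, 0 < c → ∀ {f kf h kh : PhaseSpace L → ℝ}, ContDiff ℝ 2 f → ContDiff ℝ 2 h → MemLp f 2 ((pinnedChain ω₂ lam β γ).gibbsMeasure L T) → MemLp h 2 ((pinnedChain ω₂ lam β γ).gibbsMeasure L T) → MemLp kf 2 ((pinnedChain ω₂ lam β γ).gibbsMeasure L T) → MemLp kh 2 ((pinnedChain ω₂ lam β γ).gibbsMeasure L T) → rev kf = kf → rev kh = kh → (∀ x, σ * liouvilleOp (pinnedChain ω₂ lam β γ) L f x + c * bathOp L B T f x = -kf x) → (∀ x, σ * liouvilleOp (pinnedChain ω₂ lam β γ) L h x + c * bathOp L B T h x = -kh x) → ∫ x, h x * kf x * (pinnedChain ω₂ lam β γ).gibbsDensity L T x = ∫ x, f x * kh x * (pinnedChain ω₂ lam β γ).gibbsDensity L T x :=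
  @onsager_symmetry

end Summit.AtomisticToContinuum.FouriersLaw.Theorems.SuperadditiveResistance.Kubo

end
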